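import Summits.CriticalPhenomena.PercolationContinuityZ3.Theorems.SahiMasterFamilyFCombRelShiftMatching
import Summits.CriticalPhenomena.PercolationContinuityZ3.Theorems.SahiMasterFamilyFCombShiftSigma

/-!
# The two-level Kleitman–Hall lemma (LEMMA I**), explicit compression solution (support file)

Support file (prover seat `prim-bnk-2`, gen 31; `--supports stmt-CriticalPhenomena-4575`).  Memo:
`run/shared/lean/prim/prim-l12/FROM-prim-bnk-2-g31-COMPRESSION-THEOREM.md`; statement of LEMMA I**:
`run/shared/lean/prim/prim-l12/PROBLEMS-g30-TWO-LEVEL-KLEITMAN-LEMMAS.md` (prim-bnk-2 g30; one of the two single-cube inputs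
of THEOREM Σ = CONJ V for one shared coordinate).

**`twoLevel_kleitmanHall`.**  For up-closed `P ⊆ Q` in a finite cube and a duplicate-free list `l` of ALL coordinates, the
iterated down-compression `A = D_l (Q \ P)` is down-closed, `A ⊆ σQ`, `A ∩ P = ∅`, and there are bijections `g : A ≃ Q \ P`
with `z ⊆ g z` and `h : σQ \ A ≃ P` with `y ⊆ h y`.  Equivalently the up-set `T = σA = U_l(Q \ P) = Q \ D^Q_l P` has
`|T| = |Q \ P|`, `σ(Q \ P) ≅↑ T` and `σP ≅↑ Q \ T` — LEMMA I** with an explicit witness, for every coordinate order.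

Ingredients: `D_l (σ𝒜) = D_l 𝒜` for a full list (`downs_image_compl`, file `…ShiftSigma`); a full iterated
down-compression is down-closed (`downs_subset_mem`); the complement in `Q` of a relative down-compression is a mirrored free
down-compression (`sdiff_relDowns`: `Q \ D^Q_l X = σ D_l σ(Q \ X)`); THEOREM S (`isUnit_det_incl_downs`) for `g` and
THEOREM S^rel via `exists_dominating_equiv_relDowns` for `h`.  No definitions; no `sorry`; standard axioms.
-/

namespace Summit.CriticalPhenomena.PercolationContinuityZ3.Theorems

namespace SahiFComb.Shift

open Finset FinsetFamily Matrix

variable {α : Type*} [DecidableEq α]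

/-! ### 1. Free down-compression and erasure-closed families -/

/-- A down-compression preserves closedness under erasing another coordinate. [this work] -/
theorem erase_mem_compression_of_erase_mem {c a : α} (hac : a ≠ c) {X : Finset (Finset α)}
    (hX : ∀ s ∈ X, s.erase a ∈ X) : ∀ s ∈ 𝓓 c X, s.erase a ∈ 𝓓 c X := by
  intro s hs
  rw [Down.mem_compression] at hs ⊢
  rcases hs with ⟨h1, h2⟩ | ⟨h1, h2⟩
  · left
    refine ⟨hX s h1, ?_⟩
    rw [Finset.erase_right_comm]
    exact hX _ h2
  · have hins : insert c (s.erase a) ∈ X := by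
      rw [← erase_insert_of_ne hac.symm]; exact hX _ h2
    by_cases h : s.erase a ∈ X
    · left
      have hcs : c ∉ s := fun hcs => h1 (by rwa [insert_eq_of_mem hcs] at h2)
      refine ⟨h, ?_⟩
      rwa [erase_eq_of_notMem (show c ∉ s.erase a from fun h' => hcs (mem_of_mem_erase h'))]
    · right; exact ⟨h, hins⟩

/-- After iterated down-compression along `l`, the family is closed under erasing every coordinate of `l`
(and keeps any such closedness it had before). [this work] -/
theorem erase_mem_downs :
    ∀ (l : List α) (T : Finset α) (𝒜 : Finset (Finset α)), (∀ s ∈ 𝒜, ∀ a ∈ T, s.erase a ∈ 𝒜) →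
      ∀ s ∈ l.foldl (fun 𝒴 i => 𝓓 i 𝒴) 𝒜, ∀ a, (a ∈ T ∨ a ∈ l) → s.erase a ∈ l.foldl (fun 𝒴 i => 𝓓 i 𝒴) 𝒜
  | [], T, 𝒜, h𝒜, s, hs, a, ha => by
    rcases ha with ha | ha
    · exact h𝒜 s hs a ha
    · exact absurd ha List.not_mem_nil
  | c :: l, T, 𝒜, h𝒜, s, hs, a, ha => by
    rw [List.foldl_cons] at hs ⊢
    have hstep : ∀ s ∈ 𝓓 c 𝒜, ∀ a ∈ insert c T, s.erase a ∈ 𝓓 c 𝒜 := by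
      intro s hs a ha
      rcases mem_insert.1 ha with rfl | ha
      · exact Down.erase_mem_compression_of_mem_compression hs
      · by_cases hac : a = c
        · subst hac; exact Down.erase_mem_compression_of_mem_compression hs
        · exact erase_mem_compression_of_erase_mem hac (fun t ht => h𝒜 t ht a ha) s hs
    refine erase_mem_downs l (insert c T) (𝓓 c 𝒜) hstep s hs a ?_
    rcases ha with ha | ha
    · exact Or.inl (mem_insert_of_mem ha)
    · rcases List.mem_cons.1 ha with rfl | ha
      · exact Or.inl (mem_insert_self _ _)
      · exact Or.inr ha

/-- A family closed under erasing any single coordinate is down-closed. [folklore] -/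
theorem subset_mem_of_erase_mem {X : Finset (Finset α)} (hX : ∀ s ∈ X, ∀ a, s.erase a ∈ X) :
    ∀ K ∈ X, ∀ K' ⊆ K, K' ∈ X := by
  suffices h : ∀ (n : ℕ) (K K' : Finset α), K ∈ X → K' ⊆ K → #(K \ K') = n → K' ∈ X from
    fun K hK K' hK' => h _ K K' hK hK' rfl
  intro n
  induction n with
  | zero =>
    intro K K' hK hK' hn
    have : K = K' := by
      refine Subset.antisymm ?_ hK'
      intro x hx; by_contra hx'
      have : x ∈ K \ K' := mem_sdiff.2 ⟨hx, hx'⟩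
      rw [card_eq_zero.1 hn] at this; exact absurd this (notMem_empty _)
    rwa [← this]
  | succ n ih =>
    intro K K' hK hK' hn
    obtain ⟨x, hx⟩ : (K \ K').Nonempty := by rw [← card_pos, hn]; exact Nat.succ_pos n
    have hxK : x ∈ K := (mem_sdiff.1 hx).1
    have hxK' : x ∉ K' := (mem_sdiff.1 hx).2
    refine ih (K.erase x) K' (hX K hK x) (fun y hy => mem_erase.2 ⟨fun h => hxK' (h ▸ hy), hK' hy⟩) ?_
    rw [erase_sdiff_comm, card_erase_of_mem hx, hn, Nat.add_sub_cancel]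

/-- A full iterated down-compression (every coordinate occurs in `l`) is down-closed. [this work] -/
theorem downs_subset_mem (l : List α) (hall : ∀ a : α, a ∈ l) (𝒜 : Finset (Finset α)) :
    ∀ K ∈ l.foldl (fun 𝒴 i => 𝓓 i 𝒴) 𝒜, ∀ K' ⊆ K, K' ∈ l.foldl (fun 𝒴 i => 𝓓 i 𝒴) 𝒜 :=
  subset_mem_of_erase_mem fun s hs a =>
    erase_mem_downs l ∅ 𝒜 (fun _ _ _ h => absurd h (notMem_empty _)) s hs a (Or.inr (hall a))

/-! ### 2. Complements of relative down-compressions are mirrored free down-compressions -/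

/-- One step: inside a `c`-increasing ambient `Q`, the complement in `Q` of the relative down-compression of
`X ⊆ Q` along `c` is the up-compression of `Q \\ X` along `c`, written as a mirrored down-compression. [this work] -/
theorem sdiff_relCompression [Fintype α] {Q X : Finset (Finset α)} (c : α)
    (hQ : ∀ s ∈ Q, insert c s ∈ Q) (hX : X ⊆ Q) :
    Q \ relCompression Q c X = (𝓓 c ((Q \ X).image compl)).image compl := by
  have hmemC : ∀ (Y : Finset (Finset α)) (s : Finset α), s ∈ Y.image compl ↔ sᶜ ∈ Y := by
    intro Y s
    rw [mem_image]
    constructor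
    · rintro ⟨t, ht, rfl⟩; rwa [compl_compl]
    · intro h; exact ⟨sᶜ, h, compl_compl s⟩
  ext s
  rw [hmemC, Down.mem_compression, hmemC, hmemC, hmemC, mem_sdiff, mem_relCompression]
  have e1 : (sᶜ.erase c)ᶜ = insert c s := by
    ext x; by_cases hx : x = c
    · subst hx; simp
    · simp [hx]
  have e2 : (insert c sᶜ)ᶜ = s.erase c := by
    ext x; by_cases hx : x = c
    · subst hx; simp
    · simp [hx]
  rw [e1, e2, compl_compl, mem_sdiff, mem_sdiff, mem_sdiff]
  by_cases hsX : s ∈ X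
  · have hsQ : s ∈ Q := hX hsX
    constructor
    · rintro ⟨-, h⟩
      right
      refine ⟨fun h' => h'.2 hsX, ?_, ?_⟩
      · by_contra h'; exact h (Or.inl ⟨hsX, Or.inr h'⟩)
      · intro h'; exact h (Or.inl ⟨hsX, Or.inl h'⟩)
    · rintro (⟨⟨-, h⟩, -⟩ | ⟨-, h1, h2⟩)
      · exact absurd hsX h
      · refine ⟨hsQ, ?_⟩
        rintro (⟨-, h | h⟩ | ⟨h, -⟩)
        · exact h2 h
        · exact h h1
        · exact h hsX
  · constructor
    · rintro ⟨hsQ, h⟩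
      left
      refine ⟨⟨hsQ, hsX⟩, hQ s hsQ, fun h' => h (Or.inr ⟨hsX, h', hsQ⟩)⟩
    · rintro (⟨⟨hsQ, -⟩, -, h⟩ | ⟨h0, h1, -⟩)
      · exact ⟨hsQ, fun h' => h'.elim (fun h'' => hsX h''.1) (fun h'' => h h''.2.1)⟩
      · exfalso
        have hsQ : s ∉ Q := fun h => h0 ⟨h, hsX⟩
        by_cases hcs : c ∈ s
        · exact hsQ (by rw [← insert_erase hcs]; exact hQ _ h1)
        · exact hsQ (by rw [← erase_eq_of_notMem hcs]; exact h1)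

/-- Iterated version: inside an up-closed (`c`-increasing for every `c ∈ l`) ambient `Q`, the complement in `Q`
of the iterated relative down-compression of `X ⊆ Q` is the mirror image of the iterated free down-compression of
the mirror image of `Q \\ X`. [this work] -/
theorem sdiff_relDowns [Fintype α] :
    ∀ (l : List α) (Q X : Finset (Finset α)), (∀ c ∈ l, ∀ s ∈ Q, insert c s ∈ Q) → X ⊆ Q →
      Q \ l.foldl (fun 𝒴 i => relCompression Q i 𝒴) X =
        (l.foldl (fun 𝒴 i => 𝓓 i 𝒴) ((Q \ X).image compl)).image compl
  | [], Q, X, _, _ => by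
    rw [List.foldl_nil, List.foldl_nil, Finset.image_image, compl_comp_compl, Finset.image_id]
  | c :: l, Q, X, hQ, hX => by
    rw [List.foldl_cons, List.foldl_cons,
      sdiff_relDowns l Q (relCompression Q c X) (fun c' hc' => hQ c' (List.mem_cons_of_mem _ hc'))
        (relCompression_subset hX),
      sdiff_relCompression c (hQ c List.mem_cons_self) hX, Finset.image_image, compl_comp_compl, Finset.image_id]

/-! ### 3. LEMMA I** (two-level Kleitman–Hall), explicit form -/

/-- **LEMMA I** of the one-shared-coordinate programme (prim-bnk-2 g30), EXPLICIT FORM (g31, memo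
FROM-prim-bnk-2-g31-COMPRESSION-THEOREM.md).**  Let `P ⊆ Q` be up-closed families in a finite cube, `l` a duplicate-free
list of ALL coordinates, and `A = D_l (Q \\ P)` the iterated down-compression of `Q \\ P`.  Then `A` is down-closed,
`A ⊆ σQ` (`σ` = complementation), `A` is disjoint from `P`, there is a bijection `g : A ≃ Q \\ P` with `z ⊆ g z`, and there
is a bijection `h : σQ \\ A ≃ P` with `y ⊆ h y`.  (Equivalently: the up-set `T = σA = U_l (Q \\ P) = Q \\ D^Q_l P`
satisfies `|T| = |Q \\ P|`, `σ(Q \\ P) ≅↑ T`, `σP ≅↑ Q \\ T` — the statement in `PROBLEMS-g30-TWO-LEVEL-KLEITMAN-LEMMAS.md`.)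
Ingredients: THEOREM S (`g`), THEOREM S^rel via `exists_dominating_equiv_relDowns` (`h`), `sdiff_relDowns` and
`downs_image_compl` (`σ(Q \\ D^Q_l P) = D_l σ(Q \\ P) = D_l (Q \\ P) = A`). [this work] -/
theorem twoLevel_kleitmanHall [Fintype α] [LinearOrder α] (P Q : Finset (Finset α))
    (hP : ∀ K ∈ P, ∀ K', K ⊆ K' → K' ∈ P) (hQ : ∀ K ∈ Q, ∀ K', K ⊆ K' → K' ∈ Q) (hPQ : P ⊆ Q)
    (l : List α) (hl : l.Nodup) (hall : ∀ a : α, a ∈ l)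
    (A : Finset (Finset α)) (hA : A = l.foldl (fun 𝒴 i => 𝓓 i 𝒴) (Q \ P)) :
    (∀ K ∈ A, ∀ K' ⊆ K, K' ∈ A) ∧ A ⊆ Q.image compl ∧ Disjoint A P ∧
      (∃ g : ↥A ≃ ↥(Q \ P), ∀ z : ↥A, (z : Finset α) ⊆ ((g z : ↥(Q \ P)) : Finset α)) ∧
      (∃ h : ↥(Q.image compl \ A) ≃ ↥P, ∀ y : ↥(Q.image compl \ A), (y : Finset α) ⊆ ((h y : ↥P) : Finset α)) := by
  have hmemC : ∀ (Y : Finset (Finset α)) (s : Finset α), s ∈ Y.image compl ↔ sᶜ ∈ Y := by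
    intro Y s
    rw [mem_image]
    constructor
    · rintro ⟨t, ht, rfl⟩; rwa [compl_compl]
    · intro h; exact ⟨sᶜ, h, compl_compl s⟩
  -- (i) down-closed
  have hdown : ∀ K ∈ A, ∀ K' ⊆ K, K' ∈ A := by rw [hA]; exact downs_subset_mem l hall (Q \ P)
  -- the relative compression `P*` and `Q \ P* = σA`
  set Pstar : Finset (Finset α) := l.foldl (fun 𝒴 i => relCompression Q i 𝒴) P with hPstar
  have hPstarQ : Pstar ⊆ Q := relDowns_subset Q l P hPQ
  have hQP : Q \ Pstar = A.image compl := by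
    rw [hPstar, sdiff_relDowns l Q P (fun c _ s hs => hQ s hs _ (subset_insert c s)) hPQ, hA]
    congr 1
    exact downs_image_compl l hl hall (Q \ P)
  -- (ii) A ⊆ σQ
  have hAQ : A ⊆ Q.image compl := by
    intro K hK
    rw [hmemC]
    have : Kᶜ ∈ A.image compl := mem_image.2 ⟨K, hK, rfl⟩
    rw [← hQP] at this
    exact (mem_sdiff.1 this).1
  -- (iv) the bijection `A ≃ Q \ P` (THEOREM S)
  have hg : ∃ g : ↥A ≃ ↥(Q \ P), ∀ z : ↥A, (z : Finset α) ⊆ ((g z : ↥(Q \ P)) : Finset α) := by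
    have hcard : Fintype.card ↥(Q \ P) = Fintype.card ↥A := by
      simp only [Fintype.card_coe, hA, card_downs]
    let e : ↥(Q \ P) ≃ ↥A := Fintype.equivOfCardEq hcard
    have hS : IsUnit ((incl A (Q \ P)).submatrix e id).det := by
      have key : ∀ (X : Finset (Finset α)), X = l.foldl (fun 𝒴 i => 𝓓 i 𝒴) (Q \ P) →
          ∀ e' : ↥(Q \ P) ≃ ↥X, IsUnit ((incl X (Q \ P)).submatrix e' id).det := by
        intro X hX e'; subst hX; exact isUnit_det_incl_downs l hl (Q \ P) e'
      exact key A hA e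
    have hne : ((incl A (Q \ P)).submatrix e id).det ≠ 0 := hS.ne_zero
    rw [Matrix.det_apply'] at hne
    obtain ⟨σ, -, hσ⟩ := Finset.exists_ne_zero_of_sum_ne_zero hne
    have hσ' : ∀ i : ↥(Q \ P), ((incl A (Q \ P)).submatrix e id) (σ i) i ≠ 0 := fun i =>
      (Finset.prod_ne_zero_iff.1 (mul_ne_zero_iff.1 hσ).2) i (Finset.mem_univ _)
    refine ⟨(σ.trans e).symm, fun z => ?_⟩
    have hz := hσ' ((σ.trans e).symm z)
    simp only [submatrix_apply, incl_apply, id_eq, ne_eq, ite_eq_right_iff, one_ne_zero, imp_false, not_not,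
      Equiv.symm_trans_apply, Equiv.apply_symm_apply] at hz
    convert hz using 2
    exact Equiv.symm_trans_apply _ _ _
  -- (iii) A ∩ P = ∅
  have hdisj : Disjoint A P := by
    obtain ⟨g, hg'⟩ := hg
    rw [Finset.disjoint_left]
    intro K hKA hKP
    have h1 := hg' ⟨K, hKA⟩
    have h2 : ((g ⟨K, hKA⟩ : ↥(Q \ P)) : Finset α) ∈ Q \ P := (g ⟨K, hKA⟩).2
    exact (mem_sdiff.1 h2).2 (hP K hKP _ h1)
  -- (v) the bijection `σQ \ A ≃ P` (THEOREM S^rel)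
  have hh : ∃ h : ↥(Q.image compl \ A) ≃ ↥P,
      ∀ y : ↥(Q.image compl \ A), (y : Finset α) ⊆ ((h y : ↥P) : Finset α) := by
    have hQc : ∀ ⦃F G K : Finset α⦄, F ∈ Q → G ∈ Q → F ⊆ K → K ⊆ G → K ∈ Q :=
      fun F G K hF _ hFK _ => hQ F hF K hFK
    obtain ⟨φ, hφ⟩ := exists_dominating_equiv_relDowns Q P hQc hP hPQ l hl Pstar hPstar
    -- `σQ \ A = σ P*`
    have hmem1 : ∀ y : Finset α, y ∈ Q.image compl \ A → yᶜ ∈ Pstar := by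
      intro y hy
      rw [mem_sdiff, hmemC] at hy
      by_contra h
      have : yᶜ ∈ Q \ Pstar := mem_sdiff.2 ⟨hy.1, h⟩
      rw [hQP, hmemC, compl_compl] at this
      exact hy.2 this
    have hmem2 : ∀ w : Finset α, w ∈ Pstar → wᶜ ∈ Q.image compl \ A := by
      intro w hw
      rw [mem_sdiff, hmemC, compl_compl]
      refine ⟨hPstarQ hw, fun h => ?_⟩
      have : w ∈ Q \ Pstar := by rw [hQP, hmemC]; exact h
      exact (mem_sdiff.1 this).2 hw
    have hmem3 : ∀ x : Finset α, x ∈ P.image compl → xᶜ ∈ P := fun x hx => (hmemC P x).1 hx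
    let c₁ : ↥(Q.image compl \ A) → ↥Pstar := fun y => ⟨(y : Finset α)ᶜ, hmem1 _ y.2⟩
    let ψ : ↥(Q.image compl \ A) → ↥P := fun y =>
      ⟨((φ.symm (c₁ y) : ↥(P.image compl)) : Finset α)ᶜ, hmem3 _ (φ.symm (c₁ y)).2⟩
    have hψ_inj : Function.Injective ψ := by
      intro y₁ y₂ h
      have h1 : ((φ.symm (c₁ y₁) : ↥(P.image compl)) : Finset α) = ((φ.symm (c₁ y₂) : ↥(P.image compl)) : Finset α) :=
        compl_injective (congrArg Subtype.val h)
      have h2 : c₁ y₁ = c₁ y₂ := φ.symm.injective (Subtype.ext h1)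
      exact Subtype.ext (compl_injective (congrArg Subtype.val h2))
    have hcard : Fintype.card ↥(Q.image compl \ A) = Fintype.card ↥P := by
      have h1 : #(Q.image compl \ A) = #(Q.image compl) - #A := card_sdiff_of_subset hAQ
      have h2 : #(Q.image compl) = #Q := card_image_of_injective _ compl_injective
      have h3 : #A = #(Q \ P) := by rw [hA, card_downs]
      have h4 : #(Q \ P) = #Q - #P := card_sdiff_of_subset hPQ
      have h5 : #P ≤ #Q := card_le_card hPQ
      simp only [Fintype.card_coe]
      omega
    let h : ↥(Q.image compl \ A) ≃ ↥P := Equiv.ofBijective ψ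
      ((Fintype.bijective_iff_injective_and_card ψ).2 ⟨hψ_inj, hcard⟩)
    refine ⟨h, fun y => ?_⟩
    show (y : Finset α) ⊆ ((φ.symm (c₁ y) : ↥(P.image compl)) : Finset α)ᶜ
    have := hφ (φ.symm (c₁ y))
    rw [Equiv.apply_symm_apply] at this
    -- `φ.symm (c₁ y) ⊆ c₁ y = yᶜ`, so `y ⊆ (φ.symm (c₁ y))ᶜ`
    exact subset_compl_comm.1 this
  exact ⟨hdown, hAQ, hdisj, hg, hh⟩

end SahiFComb.Shift

end Summit.CriticalPhenomena.PercolationContinuityZ3.Theorems
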